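import Summits.BirchSwinnertonDyer.BirchSwinnertonDyer.Theorems.PrintCf2SplitBadTwoLineKernelOfFrame
import Summits.BirchSwinnertonDyer.BirchSwinnertonDyer.Theorems.PrintCf2SplitBadTwoCMPrimaryDyadicTableStrict
import HarnessLib

/-!
# Crux `PrintCf2.SplitBadTwoRankOneOfFacts` (stmt-BirchSwinnertonDyer-20368), road α v11, S3b′ PUSH brick (RES)(b2) — a LOCAL OBSTRUCTION:
# for `d ≡ 3 (mod 8)` the decomposition group of the LINE `K*_∞` above `v̄` acts TRIVIALLY on `W*` (all of `E[𝔮_r^∞]` is rational over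
# `(K*_∞)_𝔓`), so the strict-vs-unramified defect `H¹_nr((K*_∞)_𝔓, W*)/H¹_str` is `Hom_cont(D/I, W*) ⊇ ℚ₂/ℤ₂`-sized, not `≤ ℤ/2`

Cell `bsd-print-cf2`, EXTRA WIDTH seat `bsd-line-cf2-p1-w6` g4 (prover-bsd-line-cf2-p1-w6-g4-0); LEAD cf2-p1 g13 ASSIGN (R-RES-b) 2026-08-29T00:58:49Z
«(b2): the lifted class is in `𝔖_v̄(K*_∞, W*)` up to a finite class-uniform group; above `v̄` the defect is `H¹(G_𝔓/I_𝔓, (W*)^{I_𝔓 ∩ ker κ₂}) ≤ ℤ/2`».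
`--supports stmt-BirchSwinnertonDyer-20368` (helper, Theses-free). HONEST FRAMING: nothing here closes the crux or a registered stub; this file
is EVIDENCE against the displayed per-place bound of TURNKEY-S3B-PUSH §2(b) on the subclass `d ≡ 3 (mod 8)`, kernel-checked; BSD is not proved by
any of this; no summit statement is proved by this seat. No definition, no named fact, no `sorry`, no kit. beyond-print theorem: no.

WHAT. On every S3c/S3b′ frame (`C • W = cm7^{(d)}`, `d ≠ 0`; `K` imaginary quadratic, `2 = v·v̄`; `π² = π − 2`, `r² = r − 2`; `W* = E[𝔮_r^∞]`
pinned at `v`; `κ'` ANY `ℤ₂`-extension unramified outside `v̄`, i.e. the line `K*_∞`):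
* `smul_eq_self_of_mem_decomp_vbar_inf_kerSubgroup_of_frame` — **for `d ≡ 3 (mod 8)`, EVERY `δ ∈ D_v̄ ∩ Gal(K̄/K*_∞)` fixes EVERY point of
  `W*`**: by (C3) (-w6 g3 `mem_kerSubgroup_iff_smul_of_frame`) an element of `ker κ'` acts on `W*` as `+1` or as `−1`; by -w2 g9's dyadic table
  (`CMPrimes.smul_eq_self_of_mem_decomp_vbar_of_frame`, `d ≡ 3 (8)`) every element of `D_v̄` fixes `W*[4]`, and `−1` moves a point of order `4`
  (`endEigenPrimaryTorsion_two_structure`: `W*[4]` is cyclic of order `4`); so the sign is `+1`.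
* `fixedPoints_decomp_vbar_inf_kerSubgroup_eq_top_of_frame` — the same as `(W*)^{D_v̄ ⊓ ker κ'} = ⊤`; in particular `(W*)^{I_v̄ ⊓ ker κ'} = ⊤` and a
  Frobenius of the line above `v̄` acts trivially: the local group `(W*)^{I_𝔓 ∩ ker κ₂}/(Frob − 1)` of (R-RES-b) is ALL of `W* ≅ ℚ₂/ℤ₂` (infinite)
  on this subclass, and `H¹_nr((K*_∞)_𝔓, W*) ⊇ Hom_cont(D_𝔓/I_𝔓, W*)`.
CONSEQUENCE (for LEAD / cf2c-w8): «Finite (I ⧸ g(𝔖))» for Agboola's STRICT-at-`v̄` group `𝔖 = restrictedSelmerZp κ₂ W* v̄` against the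
UNRAMIFIED-at-`v̄` two-variable group `unrSelmer₂` is not a sum of `≤ ℤ/2` local defects on `d ≡ 3 (8)`; it is a global statement about the
image of the line classes in `⊕_{𝔓 ∣ v̄} Hom_cont(Ẑ, W*)`. Option (α) of this seat's STATUS line: run the push with the non-strict line group
(GV `datumSelmer (ker κ₂) … (bdpData … v̄) ∅`, unramified at `v̄`), whose restriction to `K̃_∞` matches `unrSelmer₂` place by place.

References: [Agboola2007] §3 Prop. 3.2, §4; [GreenbergLNM1716] §3 Lemmas 3.1–3.3; [Rubin1999] §3 Cor. 3.17; [deShalit1987] II §1.9, §4.17.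
-/

noncomputable section

open scoped Classical

set_option linter.dupNamespace false
set_option autoImplicit false

open NumberField IsDedekindDomain Field WeierstrassCurve
open Literature.NumberTheory.EllipticCurves Literature.NumberTheory.EllipticCurves.GreenbergSelmer
open Literature.NumberTheory.GaloisRepresentations

namespace Summit.BirchSwinnertonDyer.BirchSwinnertonDyer.Theorems.PrintCf2.RestrictedSelmerPair

open Summit.BirchSwinnertonDyer.BirchSwinnertonDyer.Theorems.PrintCf2.AdditiveAtSeven
open Summit.BirchSwinnertonDyer.BirchSwinnertonDyer.Theorems.PrintCf2.CMPrimes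

variable {K : Type} [Field K] [NumberField K]

/-- **For `d ≡ 3 (mod 8)` the decomposition group of the line above `v̄` acts TRIVIALLY on `W*`.** Frame: `C • W = cm7^{(d)}`, `d ≠ 0`,
`d ≡ 3 (8)`; `K` imaginary quadratic, `2 = v·v̄`; `π² = π − 2`, `r² = r − 2`; pinning clause at `v` for `W* = E[𝔮_r^∞]`; `κ'` unramified
outside `v̄`. Then every `δ ∈ D_v̄ ⊓ ker κ'` fixes every `x ∈ W*` ((C3): `δ` acts as `±1`; `D_v̄` fixes the cyclic group `W*[4]` of order 4,
on which `−1 ≠ +1`). [cite: Rubin1999, §3 Cor. 3.17] [cite: deShalit1987, II §1.9 and §4.17] [cite: Agboola2007, §3 Prop. 3.2] -/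
theorem smul_eq_self_of_mem_decomp_vbar_inf_kerSubgroup_of_frame {d : ℤ} (hd0 : d ≠ 0) (hd8 : d % 8 = 3)
    (W : WeierstrassCurve ℚ) [W.IsElliptic] (C : VariableChange ℚ) (hC : C • W = cm7.quadraticTwist (d : ℚ)) (hK : IsImaginaryQuadratic K)
    (v vbar : HeightOneSpectrum (𝓞 K)) (hv : ((2 : ℕ) : 𝓞 K) ∈ v.asIdeal) (hvbar : ((2 : ℕ) : 𝓞 K) ∈ vbar.asIdeal) (hne : vbar ≠ v)
    (π : (W.baseChange K).endRing) (hrel : (π : AddMonoid.End (W.baseChange K).geomPoints) * π = π - 2) {r : ℤ_[2]} (hr : r * r = r - 2)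
    (hpin : ∀ τ ∈ GreenbergSelmer.inertia v, ∀ x : ↥((W.baseChange K).endEigenPrimaryTorsion 2 π r), τ • x = x ∨ τ • x = -x)
    (κ' : ZpExtension K 2) (hκ' : κ'.IsUnramifiedOutside vbar)
    {δ : absoluteGaloisGroup K} (hδD : δ ∈ GreenbergSelmer.decomp vbar) (hδκ : δ ∈ κ'.kerSubgroup)
    (x : ↥((W.baseChange K).endEigenPrimaryTorsion 2 π r)) : δ • x = x := by
  haveI : Fact (Nat.Prime 2) := ⟨Nat.prime_two⟩
  have hj : W.j = -3375 := j_eq_of_smul_eq_cm7Twist hd0 W C hC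
  obtain ⟨θ, hθ⟩ := exists_sq_eq_neg_seven_of_cmEndo_mem_endRing W K hj π hrel
  -- (C3): `δ` acts on `W*` as `+1` or `−1`
  rcases (mem_kerSubgroup_iff_smul_of_frame hd0 W C hC hK v vbar hv hvbar hne π hrel hr hpin κ' hκ' δ).mp hδκ with h | h
  · exact h x
  · -- `−1` is excluded: `D_v̄` fixes a point of order `4`
    exfalso
    obtain ⟨-, -, -, -, -, -, hgen, -⟩ := endEigenPrimaryTorsion_two_structure W hj K hθ π hrel hr
    obtain ⟨g, hg, hord, -⟩ := hgen 2
    have hg4 : 4 • g = 0 := by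
      rw [show (4 : ℕ) = 2 ^ 2 from rfl, ← hord]; exact addOrderOf_nsmul_eq_zero g
    have hg2 : 2 • g ≠ 0 := fun h2 ↦ by
      have hdvd : addOrderOf g ∣ 2 := addOrderOf_dvd_of_nsmul_eq_zero h2
      rw [hord] at hdvd
      exact absurd (Nat.le_of_dvd two_pos hdvd) (by norm_num)
    have hfix : δ • g = g := smul_eq_self_of_mem_decomp_vbar_of_frame hd0 hd8 W C hC hK v vbar hv hvbar hne π hrel hr hpin hg hg4 hδD
    have hneg : δ • g = -g := by
      have h' := congrArg Subtype.val (h ⟨g, hg⟩)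
      rw [endEigenPrimaryTorsion.coe_smul] at h'
      exact h'
    apply hg2
    have h2g : g + g = 0 := by
      have := hfix.symm.trans hneg   -- g = -g
      rw [eq_neg_iff_add_eq_zero] at this
      exact this
    rw [two_nsmul, h2g]

/-- **`(W*)^{D_v̄ ⊓ ker κ'} = W*` for `d ≡ 3 (mod 8)`** (fixed subgroup form): the local coefficient group `(W*)^{I_𝔓 ∩ ker κ₂}` of (R-RES-b)
is ALL of `W*` and the line's Frobenius above `v̄` acts trivially — so «`(W*)^{I_𝔓 ∩ ker κ₂}/(Frob − 1) ≤ ℤ/2`» fails on this subclass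
(the quotient is `W* ≅ ℚ₂/ℤ₂`). [cite: Agboola2007, §3 Prop. 3.2] [cite: GreenbergLNM1716, §3 Lemma 3.3] -/
theorem fixedPoints_decomp_vbar_inf_kerSubgroup_eq_top_of_frame {d : ℤ} (hd0 : d ≠ 0) (hd8 : d % 8 = 3)
    (W : WeierstrassCurve ℚ) [W.IsElliptic] (C : VariableChange ℚ) (hC : C • W = cm7.quadraticTwist (d : ℚ)) (hK : IsImaginaryQuadratic K)
    (v vbar : HeightOneSpectrum (𝓞 K)) (hv : ((2 : ℕ) : 𝓞 K) ∈ v.asIdeal) (hvbar : ((2 : ℕ) : 𝓞 K) ∈ vbar.asIdeal) (hne : vbar ≠ v)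
    (π : (W.baseChange K).endRing) (hrel : (π : AddMonoid.End (W.baseChange K).geomPoints) * π = π - 2) {r : ℤ_[2]} (hr : r * r = r - 2)
    (hpin : ∀ τ ∈ GreenbergSelmer.inertia v, ∀ x : ↥((W.baseChange K).endEigenPrimaryTorsion 2 π r), τ • x = x ∨ τ • x = -x)
    (κ' : ZpExtension K 2) (hκ' : κ'.IsUnramifiedOutside vbar) :
    FixedPoints.addSubgroup ↥(GreenbergSelmer.decomp vbar ⊓ κ'.kerSubgroup) ↥((W.baseChange K).endEigenPrimaryTorsion 2 π r) = ⊤ := by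
  rw [eq_top_iff]
  intro x _
  rw [FixedPoints.mem_addSubgroup]
  rintro ⟨δ, hδD, hδκ⟩
  exact smul_eq_self_of_mem_decomp_vbar_inf_kerSubgroup_of_frame hd0 hd8 W C hC hK v vbar hv hvbar hne π hrel hr hpin κ' hκ' hδD hδκ x

end Summit.BirchSwinnertonDyer.BirchSwinnertonDyer.Theorems.PrintCf2.RestrictedSelmerPair

end
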